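import Summits.ABC.IUTFork.Cor312PilotIdelesPrInclusion
import Summits.ABC.IUTFork.Cor312ThetaSideSlotTransportK
import Summits.ABC.IUTFork.LDHGenuinePerImageShallow
import Literature.IUT.LogVolume.PilotDataBaseChange
import HarnessLib

/-!
# [IUTchIII] Corollary 3.12, reading (P) — the per-image Θ-READ binder `hΘP` of the K-LEVEL (P)-line certificates DISCHARGED:
# EVERY global possible image of the Θ-pilot object at the sharp real setting over `K` has procession-normalised log-volume
# `= −deĝ̲_lgp(P_Θ) ≤ −|log(Θ)|_(P) − ((l+5)/4)·log π` for every realising choice of Θ-ideles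

PROOF-ONLY file (D-0012; no definitions, no `Prop` facts) of the abc-iut cell (R2 S-chain team, seat abc-iut-s2-p9 gen 3, TARGET #2 `hΘ …
(or =)`, per-image half: abc-iut-C-cert-2 design note (ii) 2026-08-26 / C-lead ruling C-R35 (3)(γ) «name the per-image '≤' decl at the sharp
K-setting or say GAP»). TAKES NO SIDE on [IUTchIII] Cor. 3.12, on the readings (U)/(P) of `−|log(Θ)|`, or on any author.

THE BINDER. The per-image (P)-line certificates of branch C (`Conditional/AbcOfSPerImageGenuineK.lean`, abc-iut-w6-d110 p437663:
`PerImageK.cor312PerImageOf_of_S_genuineK` / `abc_of_S_perImage_genuineK`; `Conditional/AbcOfSPerImageGenuineKChosen.lean`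
`abc_of_S_perImage_v6K` p441497, realising ideles CHOSEN) carry, besides S (`PilotKummerIndRelated`) and the two region pins, ONE reading
hypothesis `hΘP`: for every GLOBAL possible image `U` of the Θ-pilot object (abc-iut-c312-6 `Cor312Vol.ImageChoice`: in every packet
`(j, v_ℚ)`, `j ∈ 𝔽_l^⋇`, a translate `Φ_{j,v_ℚ}(𝒰^Θ)` of the (Ind3)-enlarged Kummer image of the Θ-pilot object by an element `Φ` of the
subgroup generated by (Ind1), (Ind2) — abc-iut-c312-7 `Cor312.Setting.possibleImages`, [IUTchIII] Cor. 3.12 p. 173 l. 49 – p. 174 l. 3) of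
abc-iut-c312-7's print-normalised SHARP real setting over `K` at the constructed pilot datum (`settingPrVolSharp (pilotDataOfK D K)`),
the procession-normalised total log-volume of `U` is at most abc-iut-S7's per-image number `I.negLogThetaPerImage`
(`GenuineLogThetaPerImage`: `Σ_{p∈T(I)} ln ν̄(hull of the (Ind2)-slot images) + ((l+5)/4)·log π`).

THIS FILE closes it, for EVERY Θ-idele `t` realising `P_Θ` in Dupuy–Hilado's normalisation (the binders `ht0`, `hT` of the (U)-line's `hΘ`,
abc-iut-s2-p6 `Cor312ThetaSideClosedK` p447368; in particular the CHOSEN ideles of `abc_of_S_perImage_v6K`), with the EXACT value: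

* §1 (any pilot data `X` over any number field, abc-iut-c312-7's binders) `logvol_eq_of_mem_possibleImages_settingPrVolSharp` — every possible
  image in a packet is admissible with THE SAME packet-normalised log-volume as the sharp Kummer image itself: (Ind1)/(Ind2) act through
  abc-iut-c312-1's indeterminacy subgroup by volume-preserving maps (`adm_and_logvol_eq_of_mem_indGroup_Pr`, `Thm311RealDegreeFull`;
  [IUTchIII] proof of Cor. 3.12 Step (x) p. 181 l. 5–13 «the resulting log-volumes ∈ ℝ are invariant with respect to the indeterminacies
  (Ind1), (Ind2)»), and the sharp boxes do not depend on the lattice position (abc-iut-c312-7 `thetaRegion3_settingPrVolSharp_eq`, Dupuy–Hilado §4.10); hence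
  **`processionNormalized_imageChoice_settingPrVolSharp`**: for realising `t`, EVERY global possible image has procession-normalised volume
  `−deĝ̲_lgp(P_Θ)` (abc-iut-c312-7 `processionNormalized_thetaRegion_settingPrVolSharp`, Dupuy–Hilado Thm. 3.10.1);
* §2 (at `K`, for an initial Θ-datum `D` and ANY genuine Θ-volume input `I` OF `D`) `ndegLgp_thetaPilot_pilotDataOfK_eq` — `deĝ̲_lgp` of the
  `K`-level Θ-pilot equals that of abc-iut-S2's `pilotData D` over `F_mod` (Literature `PilotData.ndegLgp_thetaPilot_eq_of_jE_eq`, [IUTchIV]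
  Def. 1.9 (i) / Thm. 1.10 p. 23 «independent of the choice of `F□`», with abc-iut-s2-p7's `mem_S_pilotDataOfK_iff_finBelow_mem`,
  `pilotDataOfK_jE_eq_algebraMap_jMod`); then **`processionNormalized_imageChoice_settingPrVolSharp_pilotDataOfK_eq`** (`= −deĝ̲_lgp(I.X.P_Θ)`),
  **`…_le_nonarch`** (`≤ I.negLogThetaPerImageNonarch`, abc-iut-c312-d1's free inequality `DHData.free_inequality_perImage_input`),
  **`…_add_arch_le`** (`+ ((l+5)/4)·log π ≤ I.negLogThetaPerImage`), **`…_le_genuine`** (the binder `hΘP` AS TYPED) and **`…_lt_genuine`**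
  (STRICT: the slack is at least the archimedean summand, [IUTchIV] Thm. 1.10 Step (vii));
* companion `Cor312ThetaSidePerImageKDatum` — the same PER DATUM `T : Cor22.ThetaVolumeDatumAt P l` (any realising `t`), and LITERALLY the
  binder `hΘP` of `abc_of_S_perImage_v6K` (p441497) at its chosen realising ideles (`imageChoice_settingPrVolSharp_pilotDataOfK_chosen_le_datum`).

READING (statement about OUR typed objects, numbers not adjectives). On the (P) line the READ binder is not merely dischargeable but
CONTENT-FREE at realising ideles: the per-image volumes never see (Ind1)/(Ind2) (all equal to the bare `−deĝ̲_lgp(P_Θ)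
= −((ℓ⋇+1)(2ℓ⋇+1)/6)·deĝ̲(P_q)`), and `hΘP` holds with slack `≥ ((l+5)/4)·log π > 0`; whatever the (P)-line certificates derive from S, it is
not through this binder. p437663's family apex leaves `t` FREE; its blanket `hΘP` over non-realising `t` is not addressed here (the volume of a
possible image is `Σ Pr·log ‖t‖`, unbounded in `t`) — the line of record p441497 CHOOSES realising ideles, and the companion file closes its binder outright.

[cite: Mochizuki2012, IUTchIII Cor. 3.12 p. 173–174; proof Step (x) p. 181] [cite: Mochizuki2012, IUTchIV Def. 1.9 (i) p. 22; Thm. 1.10 p. 23,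
Steps (v)–(viii) p. 27–30] [cite: Mochizuki2012, IUTchI Def. 3.1 (b),(c),(e) p. 61–62; Ex. 3.2 (iv) p. 71] [cite: DupuyHilado2025, Def. 3.1.1,
§3.3, §3.4, Thm. 3.10.1, §4.10–4.12] [claim: Mochizuki2012, status: disputed] for every quoted construction. HONEST FRAMING: a comparison between
OUR two typings of one printed quantity at the datum; it removes a READING hypothesis from CONDITIONAL certificates «abc ⇐ S + pins + hΘP» and
asserts nothing about [IUTchIII] Cor. 3.12 (either reading), about S, or about abc; no side is taken on any author; typed ≠ proved;
instantiated ≠ endorsed.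
-/

noncomputable section

open Set Function NumberField IsDedekindDomain
open scoped Pointwise

namespace Summit.ABC.IUTFork.Thm311.Real

open Cor312 Cor312Vol Cor312Prov Literature.IUT.LogThetaLattice Literature.IUT.LogVolume Literature.IUT.HodgeTheaters
  Literature.NumberTheory.NumberFields

/-! ## §1. Any pilot data, realising Θ-ideles: EVERY possible image of the Θ-pilot object has the volume of the sharp Kummer image -/

section Generic

variable {F : Type} [Field F] [NumberField F] (X : PilotData F) {logv : PadicLogs F} (hlog : LogvAnalytic logv)
  (M : Type) [Field M] [NumberField M]
  (archPk : ∀ (j : (thetaIndex X).Label) (vQ : (thetaIndex X).VQ), Set ((logShellsDH X logv).Packet j vQ))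
  (archSub : ∀ (j : (thetaIndex X).Label) (v : (thetaIndex X).V),
    Set ((logShellsDH X logv).Packet j ((thetaIndex X).over v)))
  (Ψ : ℤ → ∀ v : (thetaIndex X).V, v ∈ (thetaIndex X).Vbad → Set ((logShellsDH X logv).StarPacket v))
  (act : ℤ → ∀ v : (thetaIndex X).V, v ∈ (thetaIndex X).Vbad →
    (logShellsDH X logv).StarPacket v → Module.End ℚ ((logShellsDH X logv).StarPacket v))
  (Mmod : ℤ → ∀ j : (thetaIndex X).LabelStar, Set ((logShellsDH X logv).GlobalPacket j.1))
  (region : ℤ → ∀ j : (thetaIndex X).LabelStar, FinDivisor M → ∀ vQ : (thetaIndex X).VQ,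
    Set ((logShellsDH X logv).Packet j.1 vQ))
  (n : ℤ) {HT : Type} {LogLink : HT → HT → Type} {IsFull : ∀ {s t : HT}, LogLink s t → Prop}
  (lat : LGPGaussianLogThetaLattice LogLink IsFull)
  {Frd : Type} {IsoF : Frd → Frd → Type} {Ob : Frd → Type} {realify : Frd → Frd} {Strip : Type}
  {IsoS : Strip → Strip → Type} {Mv : ∀ v : (thetaIndex X).V, v ∈ (thetaIndex X).Vbad → Type}
  [∀ v h, Monoid (Mv v h)]
  (sig : GlobalLGPFrobenioidSignature (thetaIndex X).lstar (thetaIndex X).V (· ∈ (thetaIndex X).Vbad)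
    Frd IsoF Ob realify Strip IsoS Mv)
  (split : SplittingMonoids Mv) {ObΔ : Type} {N : ∀ v : (thetaIndex X).V, v ∈ (thetaIndex X).Vbad → Type}
  [∀ v h, Monoid (N v h)] (qData : QPilotData ObΔ N)
  (tq : ∀ (pp : Nat.Primes) (x : (thetaIndex X).Fibre (.inr pp)), haveI : Fact (pp : ℕ).Prime := ⟨pp.2⟩; kOf X pp.1 x)
  (t : ∀ (pp : Nat.Primes) (_ : Fin X.lstar) (x : (thetaIndex X).Fibre (.inr pp)),
    haveI : Fact (pp : ℕ).Prime := ⟨pp.2⟩; kOf X pp.1 x)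
  (htq0 : ∀ pp x, tq pp x ≠ 0)
  (htq1 : ∀ (pp : Nat.Primes) (x : (thetaIndex X).Fibre (.inr pp)),
    haveI : Fact (pp : ℕ).Prime := ⟨pp.2⟩; placeOf X pp.1 x ∉ X.S → ‖tq pp x‖ = 1)

/-- **Every possible image of the Θ-pilot object in the packet `(j, v_ℚ)` is admissible and has THE SAME packet-normalised log-volume as the
sharp Kummer image itself** (for non-zero Θ-ideles): a possible image is `Φ_{j,v_ℚ}(𝒰^Θ)` with `Φ` in abc-iut-c312-1's subgroup generated by
(Ind1), (Ind2) (abc-iut-c312-7 `Cor312.Setting.possibleImages`), every such `Φ` carries admissible regions to admissible regions of the same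
log-volume (`adm_and_logvol_eq_of_mem_indGroup_Pr`; [IUTchIII] proof of Cor. 3.12, Step (x), p. 181 l. 5–13: «the resulting log-volumes ∈ ℝ
are invariant with respect to the indeterminacies (Ind1), (Ind2)»), and the sharp region is admissible (abc-iut-c312-7 `adm_thetaRegion3_sharp_Pr`).
[cite: Mochizuki2012, IUTchIII Cor. 3.12 proof Step (x) p. 181] [claim: Mochizuki2012, status: disputed] -/
theorem logvol_eq_of_mem_possibleImages_settingPrVolSharp (ht0 : ∀ pp i x, t pp i x ≠ 0) (j : (thetaIndex X).Label)
    (vQ : (thetaIndex X).VQ) {U : Set ((logShellsDH X logv).Packet j vQ)}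
    (hU : U ∈ (settingPrVolSharp X hlog M archPk archSub Ψ act Mmod region n lat sig split qData tq t htq0 htq1).possibleImages
      j vQ) :
    ((situationPrVol X hlog M archPk archSub Ψ act Mmod region).D n).Adm j vQ U ∧
      ((situationPrVol X hlog M archPk archSub Ψ act Mmod region).D n).logvol j vQ U =
        ((situationPrVol X hlog M archPk archSub Ψ act Mmod region).D n).logvol j vQ
          ((settingPrVolSharp X hlog M archPk archSub Ψ act Mmod region n lat sig split qData tq t htq0 htq1).thetaRegion 0
            j vQ) := by
  obtain ⟨Φ, hΦ, rfl⟩ := hU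
  rw [thetaRegion3_settingPrVolSharp_eq X hlog M archPk archSub Ψ act Mmod region n lat sig split qData t tq htq0 htq1 0 j vQ]
  exact adm_and_logvol_eq_of_mem_indGroup_Pr X hlog M archPk archSub Ψ act Mmod region n hΦ j vQ _
    (by
      rw [← thetaRegion3_settingPrVolSharp_eq X hlog M archPk archSub Ψ act Mmod region n lat sig split qData t tq htq0 htq1 0 j vQ]
      exact adm_thetaRegion3_sharp_Pr X hlog M archPk archSub Ψ act Mmod region n lat sig split qData _ _ _ t ht0 j vQ)

/-- **For Θ-ideles REALISING `P_Θ` (Dupuy–Hilado (3.4)), EVERY global possible image of the Θ-pilot object at `settingPrVolSharp` has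
procession-normalised total log-volume `−deĝ̲_lgp(P_Θ)`** — independently of the chosen (Ind1)/(Ind2)-translates in each packet: packet by packet
the volume is that of the sharp Kummer image (`logvol_eq_of_mem_possibleImages_settingPrVolSharp`), whose procession-normalised total is
abc-iut-c312-7's `processionNormalized_thetaRegion_settingPrVolSharp` (Dupuy–Hilado Thm. 3.10.1 (ii), print-normalised).
[cite: DupuyHilado2025, Thm. 3.10.1, §3.4] [cite: Mochizuki2012, IUTchIII Cor. 3.12 proof Step (x) p. 181] [claim: Mochizuki2012, status: disputed] -/
theorem processionNormalized_imageChoice_settingPrVolSharp (ht0 : ∀ pp i x, t pp i x ≠ 0)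
    (ht : ∀ (pp : Nat.Primes) (i : Fin X.lstar) (x : (thetaIndex X).Fibre (.inr pp)),
      haveI : Fact (pp : ℕ).Prime := ⟨pp.2⟩
      Real.log ‖t pp i x‖ = -(X.thetaPilot i (placeOf X pp.1 x)) * logNorm F (placeOf X pp.1 x) /
        localDegree F (placeOf X pp.1 x))
    (U : ImageChoice (settingPrVolSharp X hlog M archPk archSub Ψ act Mmod region n lat sig split qData tq t htq0 htq1)) :
    processionNormalized (fun i : Fin (thetaIndex X).lstar => ∑ᶠ vQ : (thetaIndex X).VQ,
        ((situationPrVol X hlog M archPk archSub Ψ act Mmod region).D n).logvol (Setting.labelSucc i) vQ (U.1 (i, vQ))) =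
      -LgpDivisor.ndegLgp X.thetaPilot := by
  rw [← processionNormalized_thetaRegion_settingPrVolSharp X hlog M archPk archSub Ψ act Mmod region n lat sig split qData t
    ht0 ht tq htq0 htq1 (fun _ _ => 0)]
  congr 1
  funext i
  exact finsum_congr fun vQ => (logvol_eq_of_mem_possibleImages_settingPrVolSharp X hlog M archPk archSub Ψ act Mmod
    region n lat sig split qData tq t htq0 htq1 ht0 _ vQ (U.2 (i, vQ))).2

end Generic

/-! ## §2. At `K`: `deĝ̲_lgp(P_Θ)` does not see the field; the per-image READ binder `hΘP` DISCHARGED (exact value, `≤`, `<`, slack) -/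

section AtK

variable {F K Fbar : Type} [Field F] [NumberField F] [Field K] [NumberField K] [Algebra F K] [Field Fbar]
  [Algebra F Fbar] [Algebra K Fbar] {E : WeierstrassCurve F} [E.IsElliptic] {l : ℕ} {Pb : BadPlacePredicates K}
  (D : InitialThetaData F K Fbar E l Pb)

/-- **`deĝ̲_lgp(P_Θ)` does not see the field**: the normalised lgp-degree of the Θ-pilot of abc-iut-C-cert-3's `K`-level pilot datum
`pilotDataOfK D K` equals that of abc-iut-S2's `pilotData D` over `F_mod` — Literature `PilotData.ndegLgp_thetaPilot_eq_of_jE_eq` ([IUTchIV]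
Def. 1.9 (i): `P_{Θ,j}(K) = P_{Θ,j}|_K`, `deĝ̲(𝔞|_K) = deĝ̲(𝔞)`; Thm. 1.10 p. 23 «independent of the choice of `F□`») fed with abc-iut-s2-p7's
`mem_S_pilotDataOfK_iff_finBelow_mem` (`S_K` = the places over `V^bad_mod`) and `pilotDataOfK_jE_eq_algebraMap_jMod` (`j_E ∈ F_mod` viewed in `K`).
[cite: Mochizuki2012, IUTchIV Def. 1.9 (i) p. 22; Thm. 1.10 p. 23] [cite: DupuyHilado2025, Def. 3.1.1, §3.3] -/
theorem ndegLgp_thetaPilot_pilotDataOfK_eq :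
    LgpDivisor.ndegLgp (pilotDataOfK D K).thetaPilot = LgpDivisor.ndegLgp (ThetaData.pilotData D).thetaPilot :=
  PilotData.ndegLgp_thetaPilot_eq_of_jE_eq (ThetaData.pilotData D) (pilotDataOfK D K)
    (mem_S_pilotDataOfK_iff_finBelow_mem D) (by rw [pilotDataOfK_jE_eq_algebraMap_jMod, ThetaData.pilotData_jE]) rfl


section Closed

variable (M : Type) [Field M] [NumberField M]
  (archPk : ∀ (j : (thetaIndex (pilotDataOfK D K)).Label) (vQ : (thetaIndex (pilotDataOfK D K)).VQ),
    Set ((logShellsDH (pilotDataOfK D K) (analyticLogv K)).Packet j vQ))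
  (archSub : ∀ (j : (thetaIndex (pilotDataOfK D K)).Label) (v : (thetaIndex (pilotDataOfK D K)).V),
    Set ((logShellsDH (pilotDataOfK D K) (analyticLogv K)).Packet j ((thetaIndex (pilotDataOfK D K)).over v)))
  (Ψ : ℤ → ∀ v : (thetaIndex (pilotDataOfK D K)).V, v ∈ (thetaIndex (pilotDataOfK D K)).Vbad →
    Set ((logShellsDH (pilotDataOfK D K) (analyticLogv K)).StarPacket v))
  (act : ℤ → ∀ v : (thetaIndex (pilotDataOfK D K)).V, v ∈ (thetaIndex (pilotDataOfK D K)).Vbad →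
    (logShellsDH (pilotDataOfK D K) (analyticLogv K)).StarPacket v →
      Module.End ℚ ((logShellsDH (pilotDataOfK D K) (analyticLogv K)).StarPacket v))
  (Mmod : ℤ → ∀ j : (thetaIndex (pilotDataOfK D K)).LabelStar,
    Set ((logShellsDH (pilotDataOfK D K) (analyticLogv K)).GlobalPacket j.1))
  (region : ℤ → ∀ j : (thetaIndex (pilotDataOfK D K)).LabelStar, FinDivisor M → ∀ vQ : (thetaIndex (pilotDataOfK D K)).VQ,
    Set ((logShellsDH (pilotDataOfK D K) (analyticLogv K)).Packet j.1 vQ))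
  (n : ℤ) {HT : Type} {LogLink : HT → HT → Type} {IsFull : ∀ {s t : HT}, LogLink s t → Prop}
  (lat : LGPGaussianLogThetaLattice LogLink IsFull)
  {Frd : Type} {IsoF : Frd → Frd → Type} {Ob : Frd → Type} {realify : Frd → Frd} {Strip : Type}
  {IsoS : Strip → Strip → Type}
  {Mv : ∀ v : (thetaIndex (pilotDataOfK D K)).V, v ∈ (thetaIndex (pilotDataOfK D K)).Vbad → Type} [∀ v h, Monoid (Mv v h)]
  (sig : GlobalLGPFrobenioidSignature (thetaIndex (pilotDataOfK D K)).lstar (thetaIndex (pilotDataOfK D K)).V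
    (· ∈ (thetaIndex (pilotDataOfK D K)).Vbad) Frd IsoF Ob realify Strip IsoS Mv)
  (split : SplittingMonoids Mv) {ObΔ : Type}
  {N : ∀ v : (thetaIndex (pilotDataOfK D K)).V, v ∈ (thetaIndex (pilotDataOfK D K)).Vbad → Type} [∀ v h, Monoid (N v h)]
  (qData : QPilotData ObΔ N)
  (tq : ∀ (pp : Nat.Primes) (x : (thetaIndex (pilotDataOfK D K)).Fibre (.inr pp)),
    haveI : Fact (pp : ℕ).Prime := ⟨pp.2⟩; kOf (pilotDataOfK D K) pp.1 x)
  (t : ∀ (pp : Nat.Primes) (_ : Fin (pilotDataOfK D K).lstar) (x : (thetaIndex (pilotDataOfK D K)).Fibre (.inr pp)),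
    haveI : Fact (pp : ℕ).Prime := ⟨pp.2⟩; kOf (pilotDataOfK D K) pp.1 x)
  (htq0 : ∀ pp x, tq pp x ≠ 0)
  (htq1 : ∀ (pp : Nat.Primes) (x : (thetaIndex (pilotDataOfK D K)).Fibre (.inr pp)),
    haveI : Fact (pp : ℕ).Prime := ⟨pp.2⟩; placeOf (pilotDataOfK D K) pp.1 x ∉ (pilotDataOfK D K).S → ‖tq pp x‖ = 1)

/-- **At `K`, the EXACT value**: for an initial Θ-datum `D`, ANY genuine Θ-volume input `I` OF `D` (`IsVolumeInputOf`), any q-ideles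
(`htq0`, `htq1`) and EVERY realising Θ-idele `t` (`ht0`, `hT` — the binders of the (U)-line's `hΘ`, abc-iut-s2-p6 p447368), every global
possible image `U` of abc-iut-c312-7's sharp real setting over `K` at `pilotDataOfK D K` has procession-normalised total log-volume
`−deĝ̲_lgp(P_Θ)` of `I`'s pilot data (`= −((ℓ⋇+1)(2ℓ⋇+1)/6)·deĝ̲(P_q)`, Dupuy–Hilado §3.3): §1 at `X := pilotDataOfK D K` and
`ndegLgp_thetaPilot_pilotDataOfK_eq` (`I.X = pilotData D`). [cite: DupuyHilado2025, Def. 3.1.1, §3.3, Thm. 3.10.1]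
[cite: Mochizuki2012, IUTchIII Cor. 3.12 proof Step (x) p. 181; IUTchIV Thm. 1.10 p. 23] [claim: Mochizuki2012, status: disputed] -/
theorem processionNormalized_imageChoice_settingPrVolSharp_pilotDataOfK_eq (ht0 : ∀ pp i x, t pp i x ≠ 0)
    (hT : ∀ (pp : Nat.Primes) (i : Fin (pilotDataOfK D K).lstar) (x : (thetaIndex (pilotDataOfK D K)).Fibre (.inr pp)),
      haveI : Fact (pp : ℕ).Prime := ⟨pp.2⟩
      Real.log ‖t pp i x‖ = -((pilotDataOfK D K).thetaPilot i (placeOf (pilotDataOfK D K) pp.1 x)) *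
        logNorm K (placeOf (pilotDataOfK D K) pp.1 x) / localDegree K (placeOf (pilotDataOfK D K) pp.1 x))
    {I : ThetaVolumeInput (fieldOfModuli E) K} (hI : ThetaData.IsVolumeInputOf D I)
    (U : ImageChoice (settingPrVolSharp (pilotDataOfK D K) (logvAnalytic_analyticLogv (F := K)) M archPk archSub Ψ act Mmod
      region n lat sig split qData tq t htq0 htq1)) :
    processionNormalized (fun i : Fin (thetaIndex (pilotDataOfK D K)).lstar => ∑ᶠ vQ : (thetaIndex (pilotDataOfK D K)).VQ,
        ((situationPrVol (pilotDataOfK D K) (logvAnalytic_analyticLogv (F := K)) M archPk archSub Ψ act Mmod region).D n).logvol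
          (Setting.labelSucc i) vQ (U.1 (i, vQ))) =
      -LgpDivisor.ndegLgp I.X.thetaPilot := by
  rw [hI.X_eq, ← ndegLgp_thetaPilot_pilotDataOfK_eq D]
  exact processionNormalized_imageChoice_settingPrVolSharp (pilotDataOfK D K) (logvAnalytic_analyticLogv (F := K)) M archPk
    archSub Ψ act Mmod region n lat sig split qData tq t htq0 htq1 ht0 hT U

/-- **… hence at most the NONARCHIMEDEAN part of `−|log(Θ)|_(P)`**: `≤ I.negLogThetaPerImageNonarch` — abc-iut-c312-d1's free inequality in
reading (P) (`DHData.free_inequality_perImage_input`: the bare region `O_𝕃(−P_Θ)` lies in the hull of its own (Ind2)-slot orbit, so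
`−deĝ̲_lgp(P_Θ) ≤ Σ_p ln ν̄(hull(U_Θ^slot)_p)`). [cite: Mochizuki2012, IUTchIII Cor. 3.12 proof Step (x) p. 181] [cite: DupuyHilado2025, §4.11–4.12]
[claim: Mochizuki2012, status: disputed] -/
theorem processionNormalized_imageChoice_settingPrVolSharp_pilotDataOfK_le_nonarch (ht0 : ∀ pp i x, t pp i x ≠ 0)
    (hT : ∀ (pp : Nat.Primes) (i : Fin (pilotDataOfK D K).lstar) (x : (thetaIndex (pilotDataOfK D K)).Fibre (.inr pp)),
      haveI : Fact (pp : ℕ).Prime := ⟨pp.2⟩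
      Real.log ‖t pp i x‖ = -((pilotDataOfK D K).thetaPilot i (placeOf (pilotDataOfK D K) pp.1 x)) *
        logNorm K (placeOf (pilotDataOfK D K) pp.1 x) / localDegree K (placeOf (pilotDataOfK D K) pp.1 x))
    {I : ThetaVolumeInput (fieldOfModuli E) K} (hI : ThetaData.IsVolumeInputOf D I)
    (U : ImageChoice (settingPrVolSharp (pilotDataOfK D K) (logvAnalytic_analyticLogv (F := K)) M archPk archSub Ψ act Mmod
      region n lat sig split qData tq t htq0 htq1)) :
    processionNormalized (fun i : Fin (thetaIndex (pilotDataOfK D K)).lstar => ∑ᶠ vQ : (thetaIndex (pilotDataOfK D K)).VQ,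
        ((situationPrVol (pilotDataOfK D K) (logvAnalytic_analyticLogv (F := K)) M archPk archSub Ψ act Mmod region).D n).logvol
          (Setting.labelSucc i) vQ (U.1 (i, vQ))) ≤
      I.negLogThetaPerImageNonarch := by
  rw [processionNormalized_imageChoice_settingPrVolSharp_pilotDataOfK_eq D M archPk archSub Ψ act Mmod region n lat sig split
    qData tq t htq0 htq1 ht0 hT hI U]
  exact DHData.free_inequality_perImage_input I

/-- **The slack of `hΘP` is at least the archimedean summand**: (volume of any global possible image) `+ ((l+5)/4)·log π ≤ I.negLogThetaPerImage`
(abc-iut-c312-d1 `DHData.neg_ndegLgp_add_arch_le_negLogThetaPerImage`; the setting's archimedean container is trivial, [IUTchIV] Thm. 1.10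
Step (vii)'s `((l+5)/4)·log π` lives only on the datum side; `I.l = l` by `IsVolumeInputOf.l_eq`). [cite: Mochizuki2012, IUTchIV Thm. 1.10 Step (vii) p. 30]
[claim: Mochizuki2012, status: disputed] -/
theorem processionNormalized_imageChoice_settingPrVolSharp_pilotDataOfK_add_arch_le (ht0 : ∀ pp i x, t pp i x ≠ 0)
    (hT : ∀ (pp : Nat.Primes) (i : Fin (pilotDataOfK D K).lstar) (x : (thetaIndex (pilotDataOfK D K)).Fibre (.inr pp)),
      haveI : Fact (pp : ℕ).Prime := ⟨pp.2⟩
      Real.log ‖t pp i x‖ = -((pilotDataOfK D K).thetaPilot i (placeOf (pilotDataOfK D K) pp.1 x)) *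
        logNorm K (placeOf (pilotDataOfK D K) pp.1 x) / localDegree K (placeOf (pilotDataOfK D K) pp.1 x))
    {I : ThetaVolumeInput (fieldOfModuli E) K} (hI : ThetaData.IsVolumeInputOf D I)
    (U : ImageChoice (settingPrVolSharp (pilotDataOfK D K) (logvAnalytic_analyticLogv (F := K)) M archPk archSub Ψ act Mmod
      region n lat sig split qData tq t htq0 htq1)) :
    processionNormalized (fun i : Fin (thetaIndex (pilotDataOfK D K)).lstar => ∑ᶠ vQ : (thetaIndex (pilotDataOfK D K)).VQ,
        ((situationPrVol (pilotDataOfK D K) (logvAnalytic_analyticLogv (F := K)) M archPk archSub Ψ act Mmod region).D n).logvol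
          (Setting.labelSucc i) vQ (U.1 (i, vQ))) + ThetaVolumeInput.archLogTheta l ≤
      I.negLogThetaPerImage := by
  rw [processionNormalized_imageChoice_settingPrVolSharp_pilotDataOfK_eq D M archPk archSub Ψ act Mmod region n lat sig split
    qData tq t htq0 htq1 ht0 hT hI U, ← hI.l_eq]
  exact DHData.neg_ndegLgp_add_arch_le_negLogThetaPerImage I

/-- **`hΘP` DISCHARGED ON THE K-LEVEL (P) LINE (branch C), AS TYPED.** At abc-iut-c312-7's print-normalised SHARP real setting over `K` of
the pilot datum OF `D` (`settingPrVolSharp (pilotDataOfK D K)`, analytic logarithms), read off ANY q-ideles `tq` and ANY Θ-ideles `t` REALISING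
`P_Θ` (`ht0`, `hT`; [IUTchI] Ex. 3.2 (iv)), EVERY global possible image `U` of the Θ-pilot object has procession-normalised total log-volume at
most abc-iut-S7's per-image `−|log(Θ)|_(P)` of ANY genuine Θ-volume input `I` OF `D`: `… ≤ I.negLogThetaPerImage` — the binder `hΘP` of
`PerImageK.cor312PerImageOf_of_S_genuineK` (p437663 §1, `L := K`) at realising `t`. From `…_add_arch_le` and `((l+5)/4)·log π > 0`.
[cite: Mochizuki2012, IUTchIII Cor. 3.12 p. 173–174; proof Step (x) p. 181] [cite: Mochizuki2012, IUTchIV Thm. 1.10 Steps (v)–(viii) p. 27–30]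
[cite: DupuyHilado2025, §3.3, §3.4, Thm. 3.10.1, §4.10–4.12] [claim: Mochizuki2012, status: disputed] -/
theorem processionNormalized_imageChoice_settingPrVolSharp_pilotDataOfK_le_genuine (ht0 : ∀ pp i x, t pp i x ≠ 0)
    (hT : ∀ (pp : Nat.Primes) (i : Fin (pilotDataOfK D K).lstar) (x : (thetaIndex (pilotDataOfK D K)).Fibre (.inr pp)),
      haveI : Fact (pp : ℕ).Prime := ⟨pp.2⟩
      Real.log ‖t pp i x‖ = -((pilotDataOfK D K).thetaPilot i (placeOf (pilotDataOfK D K) pp.1 x)) *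
        logNorm K (placeOf (pilotDataOfK D K) pp.1 x) / localDegree K (placeOf (pilotDataOfK D K) pp.1 x))
    {I : ThetaVolumeInput (fieldOfModuli E) K} (hI : ThetaData.IsVolumeInputOf D I)
    (U : ImageChoice (settingPrVolSharp (pilotDataOfK D K) (logvAnalytic_analyticLogv (F := K)) M archPk archSub Ψ act Mmod
      region n lat sig split qData tq t htq0 htq1)) :
    processionNormalized (fun i : Fin (thetaIndex (pilotDataOfK D K)).lstar => ∑ᶠ vQ : (thetaIndex (pilotDataOfK D K)).VQ,
        ((situationPrVol (pilotDataOfK D K) (logvAnalytic_analyticLogv (F := K)) M archPk archSub Ψ act Mmod region).D n).logvol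
          (Setting.labelSucc i) vQ (U.1 (i, vQ))) ≤
      I.negLogThetaPerImage := by
  have h := processionNormalized_imageChoice_settingPrVolSharp_pilotDataOfK_add_arch_le D M archPk archSub Ψ act Mmod region n
    lat sig split qData tq t htq0 htq1 ht0 hT hI U
  linarith [ThetaVolumeInput.archLogTheta_pos l]

/-- **… and STRICTLY**: `< I.negLogThetaPerImage` (the «(or =)» of the mint ANSWERED for reading (P): never `=`; the slack is at least
`((l+5)/4)·log π`, and on the nonarchimedean side the comparison is the free inequality `−deĝ̲_lgp(P_Θ) ≤ −|log(Θ)|^{nonarch}_(P)`).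
[cite: Mochizuki2012, IUTchIV Thm. 1.10 Step (vii) p. 30] [claim: Mochizuki2012, status: disputed] -/
theorem processionNormalized_imageChoice_settingPrVolSharp_pilotDataOfK_lt_genuine (ht0 : ∀ pp i x, t pp i x ≠ 0)
    (hT : ∀ (pp : Nat.Primes) (i : Fin (pilotDataOfK D K).lstar) (x : (thetaIndex (pilotDataOfK D K)).Fibre (.inr pp)),
      haveI : Fact (pp : ℕ).Prime := ⟨pp.2⟩
      Real.log ‖t pp i x‖ = -((pilotDataOfK D K).thetaPilot i (placeOf (pilotDataOfK D K) pp.1 x)) *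
        logNorm K (placeOf (pilotDataOfK D K) pp.1 x) / localDegree K (placeOf (pilotDataOfK D K) pp.1 x))
    {I : ThetaVolumeInput (fieldOfModuli E) K} (hI : ThetaData.IsVolumeInputOf D I)
    (U : ImageChoice (settingPrVolSharp (pilotDataOfK D K) (logvAnalytic_analyticLogv (F := K)) M archPk archSub Ψ act Mmod
      region n lat sig split qData tq t htq0 htq1)) :
    processionNormalized (fun i : Fin (thetaIndex (pilotDataOfK D K)).lstar => ∑ᶠ vQ : (thetaIndex (pilotDataOfK D K)).VQ,
        ((situationPrVol (pilotDataOfK D K) (logvAnalytic_analyticLogv (F := K)) M archPk archSub Ψ act Mmod region).D n).logvol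
          (Setting.labelSucc i) vQ (U.1 (i, vQ))) <
      I.negLogThetaPerImage := by
  have h := processionNormalized_imageChoice_settingPrVolSharp_pilotDataOfK_add_arch_le D M archPk archSub Ψ act Mmod region n
    lat sig split qData tq t htq0 htq1 ht0 hT hI U
  linarith [ThetaVolumeInput.archLogTheta_pos l]

end Closed

end AtK

end Summit.ABC.IUTFork.Thm311.Real

end
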